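import Summits.ABC.IUTFork.Thm311RealIsmDHDegOne
import Summits.ABC.IUTFork.Thm311RealInd1StripSignature
import Mathlib.Algebra.Order.Archimedean.Basic
import HarnessLib

/-!
# [IUTchIII] Thm 3.11 (i) at `v ∈ 𝕍^non`: Dupuy–Hilado's `Aut_{ℚ_p}(K_v : I_v)` — hence print's (Ind1) strip part and (Ind2) — is
# UNIFORMLY BI-LIPSCHITZ: every element changes radii by a factor at most `C_v = p · max_{I_v} ‖·‖` (honest, unconditional bound)

PROOF-ONLY file (abc-iut cell, Cor. 3.12 sub-crew, seat abc-iut-c312-1 = holder of record of the typed [IUTchIII] Thm. 3.11,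
gen 10; row «R11 IND1-STRIP-MOVER-ALL-PLANES», part i — the UNCONDITIONAL counterweight).  TAKES NO SIDE on [IUTchIII] Cor. 3.12.

The movers of record (gen 9 / gen 10) show, modulo the Jannsen–Wingberg fact, that print's (Ind1) strip part INFLATES ideal-shaped
regions.  How much can it inflate?  Every element `φ` of Dupuy–Hilado's family `Real.ismDH (analyticLogv F) v`
(bicontinuous `ℚ`-linear with `φ(I_v) = I_v`, DH §4.9) — which CONTAINS print's (Ind1) strip part (`Real.ind1Strip_subset_ismDH`,
p450750) and print's (Ind2) (`ismIsm_subset_ismDH`) — is `ℚ_p`-linear by continuity (w5-d216 `IsmDHUnram.map_smul_of_continuous`)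
and preserves the log-shell `I_v`, a COMPACT set containing the unit ball `𝒪_v` (abc-iut-L4 `isCompact_logShell_ofUnitLog`,
`Real.integers_subset_shell_analyticLogv`).  Scaling any `x ≠ 0` into `𝒪_v ∖ p𝒪_v` by a power of `p` therefore gives
(**`exists_norm_of_map_le_of_mem_ismDH`**): there is ONE constant `C_v = p · max_{I_v} ‖·‖ ≥ 1` (rescaled norm of abc-iut-S7) with
`‖φ x‖ ≤ C_v ‖x‖` for ALL `φ ∈ Real.ismDH` and all `x`; applied to `φ⁻¹` (`symm_mem_ismDH`) also `‖x‖ ≤ C_v ‖φ x‖`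
(**`exists_norm_le_mul_norm_of_map_of_mem_ismDH`**).  Consequences: `φ(B(0,r)) ⊆ B(0, C_v r)` for every ball
(**`image_closedBall_subset_of_mem_ismDH`**) — the (Ind1)/(Ind2)-inflation of ANY ideal-shaped region at `v` is at most the FIXED
factor `C_v` in radius, uniformly in the region and in the automorphism; the same for print's (Ind1) strip part
(**`exists_image_closedBall_subset_of_mem_ind1Strip`**).  Together with the lower bounds of record (p481941 / p482234: strict inflation in
every window of `e(v|p)+1` balls, `f(v|p)` odd) this brackets print's (Ind1) at a finite place between «not region-rigid» and «boundedly
so».  Classical; [cite: DupuyHilado2025, §4.9]; [claim: Mochizuki2012, status: disputed] for every [IUTchIII] quotation.  typed ≠ proved.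
-/

noncomputable section

open Metric Set Function
open scoped Pointwise

namespace Summit.ABC.IUTFork.Thm311.Real

open Literature.IUT.LogVolume Literature.NumberTheory.NumberFields
open Literature.NumberTheory.GaloisRepresentations.Ultrametric
open Literature.AnabelianGeometry.AbsoluteAnabelian
open Literature.IUT.LogThetaLattice (isCompact_logShell_ofUnitLog)
open NumberField IsDedekindDomain

section Distortion

variable {F : Type} [Field F] [NumberField F] (p : ℕ) [Fact p.Prime] (v : HeightOneSpectrum (𝓞 F))
  (hv : ((p : ℕ) : 𝓞 F) ∈ v.asIdeal)

/-- `Real.ismDH` at a finite place is closed under inverses. [folklore] -/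
theorem symm_mem_ismDH {logv : PadicLogs F} {φ : Carrier (.inr v : Place F) ≃ₗ[ℚ] Carrier (.inr v : Place F)}
    (hφ : φ ∈ ismDH logv (.inr v : Place F)) : φ.symm ∈ ismDH logv (.inr v : Place F) := by
  obtain ⟨hc, hcs, himg⟩ := hφ
  refine ⟨hcs, hc, ?_⟩
  have h := congrArg (fun S => ⇑φ.symm '' S) himg
  simp only [Set.image_image, LinearEquiv.symm_apply_apply, Set.image_id'] at h
  exact h.symm

/-- **UNIFORM LIPSCHITZ BOUND for Dupuy–Hilado's `Aut_{ℚ_p}(K_v : I_v)`.**  There is a constant `C ≥ 1` (namely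
`p · max_{I_v} ‖·‖` in abc-iut-S7's rescaled norm) such that EVERY `φ ∈ Real.ismDH (analyticLogv F) v` satisfies `‖φ x‖ ≤ C·‖x‖` for
all `x ∈ K_v`.  (`φ` is `ℚ_p`-linear by continuity; scale `x ≠ 0` by a power of `p` into the unit ball `𝒪_v ⊆ I_v`, apply
`φ(I_v) = I_v` and the compactness of `I_v`.) [cite: DupuyHilado2025, §4.9] -/
theorem exists_norm_of_map_le_of_mem_ismDH (hp : residueChar F v = p) :
    ∃ C : ℝ, 1 ≤ C ∧ ∀ {φ : Carrier (.inr v : Place F) ≃ₗ[ℚ] Carrier (.inr v : Place F)},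
      φ ∈ ismDH (analyticLogv F) (.inr v : Place F) → ∀ x : Carrier (.inr v : Place F),
        ‖RescaledCompletion.of F p v hv (φ x)‖ ≤ C * ‖RescaledCompletion.of F p v hv x‖ := by
  subst hp
  set K := RescaledCompletion F (residueChar F v) v hv
  let e : Carrier (.inr v : Place F) ≃+* K := RescaledCompletion.of F (residueChar F v) v hv
  have hP : (residueChar F v).Prime := Fact.out
  have hp1 : (1 : ℝ) < residueChar F v := by exact_mod_cast hP.one_lt
  have hp0 : (0 : ℝ) < residueChar F v := lt_trans zero_lt_one hp1
  -- the shell, read on `K`: compact, contains the unit ball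
  have hshell : shell (analyticLogv F) (.inr v) =
      e.symm '' logShell (PadicLogOnUnits.ofUnitLog (residueChar F v) K) :=
    shell_eq_image_logShell_of_formula (residueChar F v) v hv (analyticLogv F) rfl
      (fun u => analyticLogv_apply F v u)
  set B : Set K := logShell (PadicLogOnUnits.ofUnitLog (residueChar F v) K) with hBdef
  have hBc : IsCompact B := isCompact_logShell_ofUnitLog (residueChar F v) K
  have hball : ∀ y : K, ‖y‖ ≤ 1 → y ∈ B := by
    intro y hy
    have hmem : e.symm y ∈ integers v := by
      have h1 : ‖(show v.adicCompletion F from e.symm y)‖ ≤ 1 := by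
        have h := RescaledCompletion.norm_eq_norm_of_pow F (residueChar F v) v hv (show v.adicCompletion F from e.symm y)
        have h2 : RescaledCompletion.of F (residueChar F v) v hv (show v.adicCompletion F from e.symm y) = y :=
          e.apply_symm_apply y
        rw [h2] at h
        rw [h]
        exact pow_le_one₀ (norm_nonneg _) hy
      exact Valued.toNormedField.norm_le_one_iff.mp h1
    have h2 : e.symm y ∈ shell (analyticLogv F) (.inr v) :=
      integers_subset_shell_analyticLogv (F := F) v hmem
    rw [hshell] at h2
    obtain ⟨b, hb, hbe⟩ := h2
    have hby : b = y := e.symm.injective hbe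
    exact hby ▸ hb
  have h1B : (1 : K) ∈ B := hball 1 (by rw [norm_one])
  obtain ⟨z₀, hz₀, hmax⟩ := hBc.exists_isMaxOn ⟨1, h1B⟩ continuous_norm.continuousOn
  have hmax' : ∀ z ∈ B, ‖z‖ ≤ ‖z₀‖ := fun z hz => hmax hz
  have hR1 : 1 ≤ ‖z₀‖ := by have h := hmax' 1 h1B; rwa [norm_one] at h
  refine ⟨(residueChar F v : ℝ) * ‖z₀‖, ?_, fun {φ} hφ x => ?_⟩
  · calc (1 : ℝ) = 1 * 1 := (mul_one 1).symm
      _ ≤ (residueChar F v : ℝ) * ‖z₀‖ := mul_le_mul hp1.le hR1 zero_le_one hp0.le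
  obtain ⟨hc, -, himg⟩ := hφ
  -- `φ` read on `K`
  let f : K →+ K := (e.symm.toAddEquiv.trans (φ.toAddEquiv.trans e.toAddEquiv)).toAddMonoidHom
  have hfc : Continuous f := hc
  have hB : f '' B = B := by
    have h1 : f '' B = e '' (⇑φ '' (e.symm '' B)) := by
      rw [Set.image_image, Set.image_image]
      rfl
    rw [h1, ← hshell, himg, hshell, Set.image_image]
    simp only [RingEquiv.apply_symm_apply, Set.image_id']
  have hfx : RescaledCompletion.of F (residueChar F v) v hv (φ x) = f (e x) := by
    change e (φ x) = e (φ (e.symm (e x)))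
    rw [e.symm_apply_apply]
  rw [hfx]
  change ‖f (e x)‖ ≤ (residueChar F v : ℝ) * ‖z₀‖ * ‖e x‖
  set y : K := e x with hy
  by_cases hy0 : y = 0
  · rw [hy0, map_zero, norm_zero, mul_zero]
  · -- scale `y` into `𝒪 ∖ p𝒪`: `p^n < ‖y‖ ≤ p^{n+1}`, `c = p^{n+1}`
    obtain ⟨n, hn1, hn2⟩ := exists_mem_Ioc_zpow (norm_pos_iff.mpr hy0) hp1
    set c : ℚ_[residueChar F v] := (residueChar F v : ℚ_[residueChar F v]) ^ (n + 1) with hcdef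
    have hcnorm : ‖c‖ = ((residueChar F v : ℝ) ^ (n + 1))⁻¹ := by
      rw [hcdef, norm_zpow, Padic.norm_p, inv_zpow]
    have hc0 : 0 < ‖c‖ := by rw [hcnorm]; exact inv_pos.mpr (zpow_pos hp0 _)
    have hcy : ‖c • y‖ ≤ 1 := by
      rw [norm_smul, hcnorm, inv_mul_le_iff₀ (zpow_pos hp0 _), mul_one]
      exact hn2
    have hfcy : f (c • y) ∈ B := by
      rw [← hB]; exact Set.mem_image_of_mem f (hball _ hcy)
    have hle : ‖f (c • y)‖ ≤ ‖z₀‖ := hmax' _ hfcy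
    rw [IsmDHUnram.map_smul_of_continuous f hfc c y, norm_smul, hcnorm, inv_mul_le_iff₀ (zpow_pos hp0 _)] at hle
    -- `‖f y‖ ≤ p^{n+1} ‖z₀‖ = p · p^n · ‖z₀‖ ≤ p · ‖y‖ · ‖z₀‖`
    calc ‖f y‖ ≤ (residueChar F v : ℝ) ^ (n + 1) * ‖z₀‖ := hle
      _ = (residueChar F v : ℝ) * ((residueChar F v : ℝ) ^ n * ‖z₀‖) := by
          rw [zpow_add_one₀ hp0.ne']; ring
      _ ≤ (residueChar F v : ℝ) * (‖y‖ * ‖z₀‖) :=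
          mul_le_mul_of_nonneg_left (mul_le_mul_of_nonneg_right hn1.le (norm_nonneg _)) hp0.le
      _ = (residueChar F v : ℝ) * ‖z₀‖ * ‖y‖ := by ring

/-- **UNIFORM BI-LIPSCHITZ**: with the same constant, `‖x‖ ≤ C·‖φ x‖` as well (apply the bound to `φ⁻¹ ∈ Real.ismDH`).
[cite: DupuyHilado2025, §4.9] -/
theorem exists_norm_le_mul_norm_of_map_of_mem_ismDH (hp : residueChar F v = p) :
    ∃ C : ℝ, 1 ≤ C ∧ ∀ {φ : Carrier (.inr v : Place F) ≃ₗ[ℚ] Carrier (.inr v : Place F)},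
      φ ∈ ismDH (analyticLogv F) (.inr v : Place F) → ∀ x : Carrier (.inr v : Place F),
        ‖RescaledCompletion.of F p v hv (φ x)‖ ≤ C * ‖RescaledCompletion.of F p v hv x‖ ∧
        ‖RescaledCompletion.of F p v hv x‖ ≤ C * ‖RescaledCompletion.of F p v hv (φ x)‖ := by
  obtain ⟨C, hC1, hC⟩ := exists_norm_of_map_le_of_mem_ismDH p v hv hp
  refine ⟨C, hC1, fun {φ} hφ x => ⟨hC hφ x, ?_⟩⟩
  have h := hC (symm_mem_ismDH v hφ) (φ x)
  rwa [LinearEquiv.symm_apply_apply] at h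

/-- **BOUNDED INFLATION OF EVERY BALL** (rescaled norm, read through the identity `of`): every `φ ∈ Real.ismDH (analyticLogv F) v`
maps `B(0, r)` into `B(0, C_v r)`, ONE constant `C_v ≥ 1` for all `φ` and all `r`. [cite: DupuyHilado2025, §4.9] -/
theorem exists_image_closedBall_subset_of_mem_ismDH (hp : residueChar F v = p) :
    ∃ C : ℝ, 1 ≤ C ∧ ∀ {φ : Carrier (.inr v : Place F) ≃ₗ[ℚ] Carrier (.inr v : Place F)},
      φ ∈ ismDH (analyticLogv F) (.inr v : Place F) → ∀ r : ℝ,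
        (fun y => RescaledCompletion.of F p v hv (φ ((RescaledCompletion.of F p v hv).symm y))) ''
            closedBall (0 : RescaledCompletion F p v hv) r ⊆
          closedBall (0 : RescaledCompletion F p v hv) (C * r) := by
  obtain ⟨C, hC1, hC⟩ := exists_norm_of_map_le_of_mem_ismDH p v hv hp
  refine ⟨C, hC1, fun {φ} hφ r => ?_⟩
  rintro _ ⟨y, hy, rfl⟩
  rw [mem_closedBall_zero_iff] at hy ⊢
  have h := hC hφ ((RescaledCompletion.of F p v hv).symm y)
  rw [RingEquiv.apply_symm_apply] at h
  exact h.trans (mul_le_mul_of_nonneg_left hy (le_trans zero_le_one hC1))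

/-- **PRINT'S (Ind1) STRIP PART INFLATES BOUNDEDLY** (unconditional): every element of `Real.ind1Strip (analyticLogv F) v` —
print's (Ind1) strip part at `v` through THE equivariant lift and the analytic logarithm — maps `B(0,r)` into `B(0, C_v r)`, ONE
constant for all elements and radii (`Real.ind1Strip_subset_ismDH` + the bound for DH's family).  The honest counterweight to the
movers of record: not region-rigid (p482234, modulo Jannsen–Wingberg), but boundedly so. [claim: Mochizuki2012, status: disputed]
[cite: DupuyHilado2025, §4.9] -/
theorem exists_image_closedBall_subset_of_mem_ind1Strip (hp : residueChar F v = p) :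
    ∃ C : ℝ, 1 ≤ C ∧ ∀ {ψ : Carrier (.inr v : Place F) ≃ₗ[ℚ] Carrier (.inr v : Place F)},
      ψ ∈ ind1Strip (analyticLogv F) v → ∀ r : ℝ,
        (fun y => RescaledCompletion.of F p v hv (ψ ((RescaledCompletion.of F p v hv).symm y))) ''
            closedBall (0 : RescaledCompletion F p v hv) r ⊆
          closedBall (0 : RescaledCompletion F p v hv) (C * r) := by
  obtain ⟨C, hC1, hC⟩ := exists_image_closedBall_subset_of_mem_ismDH p v hv hp
  exact ⟨C, hC1, fun {ψ} hψ r => hC (ind1Strip_subset_ismDH (analyticLogv F) v hψ) r⟩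

end Distortion

end Summit.ABC.IUTFork.Thm311.Real

end
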